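import Summits.KontsevichZagierPeriods.KontsevichZagierPeriods.Theorems.RootDecompRationalCubeDichotomyLogFibreP1

/-!
# Log-fibre calculus for `RationalCubePiKernelSingle` (route `RootDecompRationalCubeDichotomy`, crux stmt-KontsevichZagierPeriods-26322) at `m = 2` · part 2/4

Cell `decomp-kz`, lens 2 (decomp-kz-lens-2 g6): the LOG-FIBRE SECTOR `Λ[E] = [[0,1]², E(y)/(1 + x·y·E(y))]`
(`E ∈ ℚ(y)` regular, `≥ 0`) is closed under the moves by RULE (2) ONLY — product rule `lam_mul`
(`Λ[E₁+E₂+yE₁E₂] ≡ Λ[E₁] + Λ[E₂]`, a fibred chart) and power rule `lam_pow`; inside it the whole `π²`-class of the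
cell's weight-2 census (`census₂ … census₆`, 15/15 pairs) and the route's `EulerInstance`
(`euler_rel : 3•[□,1/(1+xy)] − 4•[□,1/((1+x²)(1+y²))] ∈ KZ.relations`) are DECIDED with `N = 0`, and
`single_inst₂ … single_inst₆`, `single_instEuler` are the corresponding LITERAL instances of the binder list of
`RationalCubePiKernelSingle` at `m = 2` (the route decl is not referenced by name, so these modules do not import
the route file).

Source: `HOME/decomp-kz-lens-2/g6/LogFibreCalculus.lean` sha256 73bd8b5e80afc467 (1113 l; critic decomp-kz-crit-1 g2 CLEARED
2026-08-30T08:00:40Z incl. the binder check, std axioms), split into 4 modules by the landing seat decomp-kz-census-1 g7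
(contexts re-opened per part; generic docstrings added where the source had none).  No `sorry`; standard axioms.
References: [cite: KontsevichZagier2001, §1.2].
-/

noncomputable section
open Set MeasureTheory MvPolynomial
open Literature.ModelTheory.ExponentialFields (IsSemialgebraic)
open Literature.NumberTheory.Transcendental
open Literature.NumberTheory.Transcendental.KZ
open Literature.NumberTheory.Transcendental.KZ.RFun
open Summit.KontsevichZagierPeriods.KontsevichZagierPeriods.Theorems

namespace Summit.KontsevichZagierPeriods.RootDecompRationalCubeDichotomy.LogFibre

/-- **The base power chart** `(y, x) ↦ (y^{j+1}, x)` of the closed square onto itself: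
`ℚ`-polynomial, injective, surjective (real `(j+1)`-st roots), Jacobian `(j+1) y^j ≥ 0`. -/
theorem exists_powChart (j : ℕ) :
    ∃ (Φ : (Fin 2 → ℝ) → (Fin 2 → ℝ)) (Φ' : (Fin 2 → ℝ) → (Fin 2 → ℝ) →L[ℝ] (Fin 2 → ℝ)),
      (∀ z, Φ z 0 = z 0 ^ (j + 1)) ∧ (∀ z, Φ z 1 = z 1) ∧
      IsSemialgebraicMapOn ℚ (KZ.cube 2) Φ ∧ (∀ z ∈ KZ.cube 2, HasFDerivAt Φ (Φ' z) z) ∧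
      InjOn Φ (KZ.cube 2) ∧ Φ '' KZ.cube 2 = KZ.cube 2 ∧
      (∀ z ∈ KZ.cube 2, |(Φ' z).det| = (j + 1 : ℝ) * z 0 ^ j) := by
  set Φ : (Fin 2 → ℝ) → (Fin 2 → ℝ) := fun z => ![z 0 ^ (j + 1), z 1] with hΦ
  set Φ' : (Fin 2 → ℝ) → (Fin 2 → ℝ) →L[ℝ] (Fin 2 → ℝ) :=
    fun z => LinearMap.toContinuousLinearMap (Matrix.toLin' !![(j + 1 : ℝ) * z 0 ^ j, 0; 0, 1])
    with hΦ'
  have hΦ0 : ∀ z, Φ z 0 = z 0 ^ (j + 1) := fun z => rfl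
  have hΦ1 : ∀ z, Φ z 1 = z 1 := fun z => rfl
  have hΦ'0 : ∀ z v : Fin 2 → ℝ, Φ' z v 0 = (j + 1 : ℝ) * z 0 ^ j * v 0 := by
    intro z v
    change Matrix.toLin' !![(j + 1 : ℝ) * z 0 ^ j, 0; 0, 1] v 0 = _
    rw [Matrix.toLin'_apply]
    simp [Matrix.mulVec, dotProduct, Fin.sum_univ_two]
  have hΦ'1 : ∀ z v : Fin 2 → ℝ, Φ' z v 1 = v 1 := by
    intro z v
    change Matrix.toLin' !![(j + 1 : ℝ) * z 0 ^ j, 0; 0, 1] v 1 = _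
    rw [Matrix.toLin'_apply]
    simp [Matrix.mulVec, dotProduct, Fin.sum_univ_two]
  have hdet : ∀ z, (Φ' z).det = (j + 1 : ℝ) * z 0 ^ j := by
    intro z
    change LinearMap.det (Matrix.toLin' !![(j + 1 : ℝ) * z 0 ^ j, 0; 0, 1]) = _
    rw [LinearMap.det_toLin', Matrix.det_fin_two]
    simp only [Matrix.of_apply, Matrix.cons_val', Matrix.cons_val_zero, Matrix.cons_val_one,
      Matrix.cons_val_fin_one, Matrix.empty_val']
    ring
  have hderiv : ∀ z, HasFDerivAt Φ (Φ' z) z := by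
    intro z
    have h0 : HasFDerivAt (fun y : Fin 2 → ℝ => y 0)
        (ContinuousLinearMap.proj (R := ℝ) (φ := fun _ : Fin 2 => ℝ) 0) z := hasFDerivAt_apply 0 z
    have h1 : HasFDerivAt (fun y : Fin 2 → ℝ => y 1)
        (ContinuousLinearMap.proj (R := ℝ) (φ := fun _ : Fin 2 => ℝ) 1) z := hasFDerivAt_apply 1 z
    rw [hasFDerivAt_pi']
    refine Fin.forall_fin_two.mpr ⟨?_, ?_⟩
    · have hf : (fun y : Fin 2 → ℝ => Φ y 0) = fun y => y 0 ^ (j + 1) :=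
        funext fun y => by rw [hΦ0]
      rw [hf]
      refine (h0.pow (j + 1)).congr_fderiv (ContinuousLinearMap.ext fun v => ?_)
      simp [hΦ'0, nsmul_eq_mul]
    · have hf : (fun y : Fin 2 → ℝ => Φ y 1) = fun y => y 1 := funext fun y => by rw [hΦ1]
      rw [hf]
      refine h1.congr_fderiv (ContinuousLinearMap.ext fun v => ?_)
      simp [hΦ'1]
  refine ⟨Φ, Φ', hΦ0, hΦ1, ?_, fun z _ => hderiv z, ?_, ?_, fun z hz => ?_⟩
  · convert isSemialgebraicMapOn_aeval KZ.isSemialgebraic_cube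
      ![MvPolynomial.X 0 ^ (j + 1), (MvPolynomial.X 1 : MvPolynomial (Fin 2) ℚ)] using 2 with z
    funext i
    fin_cases i
    · simp [hΦ0]
    · simp [hΦ1]
  · intro x hx y hy hxy
    have e0 := congrFun hxy 0
    have e1 := congrFun hxy 1
    simp only [hΦ0, hΦ1] at e0 e1
    have e0' : x 0 = y 0 := (pow_left_inj₀ (hx 0).1 (hy 0).1 (Nat.succ_ne_zero j)).mp e0
    funext i
    fin_cases i
    · exact e0'
    · exact e1
  · apply Subset.antisymm
    · rintro _ ⟨z, hz, rfl⟩ i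
      fin_cases i
      · exact ⟨by simpa [hΦ0] using pow_nonneg (hz 0).1 (j + 1),
          by simpa [hΦ0] using pow_le_one₀ (hz 0).1 (hz 0).2⟩
      · simpa [hΦ1] using hz 1
    · intro w hw
      refine ⟨![w 0 ^ ((j + 1 : ℕ) : ℝ)⁻¹, w 1], ?_, ?_⟩
      · intro i
        fin_cases i
        · exact ⟨by simpa using Real.rpow_nonneg (hw 0).1 _,
            by simpa using Real.rpow_le_one (hw 0).1 (hw 0).2 (by positivity)⟩
        · simpa using hw 1
      · have hroot : (w 0 ^ ((j : ℝ) + 1)⁻¹) ^ (j + 1) = w 0 := by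
          have h := Real.rpow_inv_natCast_pow (hw 0).1 (Nat.add_one_ne_zero j)
          push_cast at h
          exact h
        funext i
        fin_cases i
        · simp [hΦ0, hroot]
        · simp [hΦ1]
  · rw [hdet]
    exact abs_of_nonneg (mul_nonneg (by positivity) (pow_nonneg (hz 0).1 _))

/-- The pure algebra of the power rule. -/
theorem pow_identity (j : ℕ) {a x y : ℝ} (ha : 0 ≤ a) (hx : 0 ≤ x) (hy : 0 ≤ y) :
    y ^ j * a / (1 + x * y * (y ^ j * a)) =
      ((1 / ((j + 1 : ℕ) : ℚ) : ℚ) : ℝ) * (a / (1 + x * y ^ (j + 1) * a)) * ((j + 1 : ℝ) * y ^ j) := by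
  have h1 : (1 : ℝ) + x * y ^ (j + 1) * a ≠ 0 := by
    have := mul_nonneg (mul_nonneg hx (pow_nonneg hy (j + 1))) ha
    linarith
  have hyy : x * y * (y ^ j * a) = x * y ^ (j + 1) * a := by ring
  have hj : ((j : ℝ) + 1) ≠ 0 := by positivity
  rw [hyy]
  push_cast
  field_simp

/-- **Power rule** `Λ[E] ≡ (j+1) • Λ[Ej]` for `Ej(y) = y^j E(y^{j+1})` (i.e. `R_{Ej}(y) = R_E(y^{j+1})`):
the base power chart + a natural-number rescaling of the integrand. -/
theorem lam_pow (j : ℕ) {E Ej : RFun 1} (hE : ∀ t ∈ Icc (0 : ℝ) 1, 0 ≤ ev E t)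
    (hEj : ∀ t ∈ Icc (0 : ℝ) 1, 0 ≤ ev Ej t)
    (hpow : ∀ t ∈ Icc (0 : ℝ) 1, ev Ej t = t ^ j * ev E (t ^ (j + 1))) :
    KZ.of (lam E hE).rep - (j + 1) • KZ.of (lam Ej hEj).rep ∈ KZ.relations := by
  obtain ⟨Φ, Φ', hΦ0, hΦ1, hsa, hderiv, hinj, himage, hdet⟩ := exists_powChart j
  set H : RFun 2 := (const (1 / ((j + 1 : ℕ) : ℚ))).mul (lam E hE) with hH
  -- `[Λ Ej] ≡ [H]` by the chart
  have hchart : KZ.of (lam Ej hEj).rep - KZ.of H.rep ∈ KZ.relations := by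
    show KZ.Equivalent (lam Ej hEj).rep H.rep
    refine SoloBlind.equivalent_of_chart (f := (lam Ej hEj).fn) (g := H.fn) hsa hderiv hinj himage
      hdet (fun z hz => ?_) rfl (fun _ _ => rfl) rfl (fun _ _ => rfl)
    have hΦz : Φ z ∈ KZ.cube 2 := himage ▸ mem_image_of_mem Φ hz
    obtain ⟨⟨hy0, hy1⟩, hx0, -⟩ := mem_cube_two hz
    have ha : 0 ≤ ev E (z 0 ^ (j + 1)) := hE _ ⟨pow_nonneg hy0 _, pow_le_one₀ hy0 hy1⟩
    rw [fn_lam hz, hH, fn_mul, fn_const, fn_lam hΦz, hΦ0 z, hΦ1 z, hpow _ ⟨hy0, hy1⟩]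
    exact pow_identity j ha hx0 hy0
  -- `[Λ E] ≡ (j+1) • [H]`
  have hscal : KZ.of (lam E hE).rep - (j + 1) • KZ.of H.rep ∈ KZ.relations :=
    SoloBlind.of_sub_nsmul_mem_relations (j + 1) rfl fun x _ => by
      rw [rep_integrand, rep_integrand, hH, fn_mul, fn_const]
      have hj : ((j : ℝ) + 1) ≠ 0 := by positivity
      push_cast
      field_simp
  have := sub_mem hscal (AddSubgroup.nsmul_mem _ hchart (j + 1))
  convert this using 1
  rw [smul_sub]
  abel

/-! ## 5. The weight-two census: the `π²`-class of `[0,1]²` decided inside the `Λ`-calculus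

Fourteen one-variable data `E` (all `≥ 0` on `[0,1]`, so `R_E = 1 + yE ≥ 1`), the relations the
product rule (`lam_mul`) and the power rule (`lam_pow`) give between their `Λ`'s, and the resulting
INTEGER CERTIFICATES for the five cross-denominator classes of the `m = 2` census whose value lies in
`ℚπ²` (`census/data/cubebox-m2v1/census-m2-v1.md`, class `π²`):
`k • [□, 1/Qᵢ] - l • [□, 1/(1+xy)] ∈ relations` with explicit `(k, l)`, hence five literal
instances of `RationalCubePiKernelSingle` (`m = 2`, `N = 0`). -/

section Census

/-! ### One-variable data and their `Λ`'s -/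

/-- `E = 1` (`Λ[1] = [□, 1/(1+xy)]`, value `π²/12`). -/
def eOne : RFun 1 := poly 1
/-- `E = y`. -/
def eY : RFun 1 := poly (X 0)
/-- `E = y²`. -/
def eYsq : RFun 1 := poly (X 0 ^ 2)
/-- `E = 1 + y`. -/
def e1Y : RFun 1 := poly (1 + X 0)
/-- `E = y + y³`. -/
def eYY3 : RFun 1 := poly (X 0 + X 0 ^ 3)
/-- `E = 1 + y + y² + y³ + y⁴`. -/
def eT1 : RFun 1 := poly (1 + X 0 + X 0 ^ 2 + X 0 ^ 3 + X 0 ^ 4)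
/-- `E = 2 + y`. -/
def e2Y : RFun 1 := poly (2 + X 0)
/-- `E = 1 + y + y²`. -/
def e1YY2 : RFun 1 := poly (1 + X 0 + X 0 ^ 2)
/-- `E = 2 + 2y + y²`. -/
def e22YY2 : RFun 1 := poly (2 + 2 * X 0 + X 0 ^ 2)

/-- `1 - y + y² ≠ 0`. -/
theorem q3_ne : ∀ y ∈ KZ.cube 1, aeval y (1 - X 0 + X 0 ^ 2 : MvPolynomial (Fin 1) ℚ) ≠ 0 := by
  intro y _
  simp only [map_add, map_sub, map_one, map_pow, aeval_X]
  have : (0 : ℝ) < 1 - y 0 + y 0 ^ 2 := by nlinarith [sq_nonneg (y 0 - 1 / 2)]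
  exact this.ne'

/-- `1 + y² ≠ 0`. -/
theorem q4_ne : ∀ y ∈ KZ.cube 1, aeval y (1 + X 0 ^ 2 : MvPolynomial (Fin 1) ℚ) ≠ 0 := by
  intro y _
  simp only [map_add, map_one, map_pow, aeval_X]
  positivity

/-- `1 + y + y² ≠ 0` on `[0,1]`. -/
theorem q6_ne : ∀ y ∈ KZ.cube 1, aeval y (1 + X 0 + X 0 ^ 2 : MvPolynomial (Fin 1) ℚ) ≠ 0 := by
  intro y hy
  have h0 := (hy 0).1
  simp only [map_add, map_one, map_pow, aeval_X]
  positivity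

/-- `E = 2/(1 - y + y²)` (`R_E = (1+y)²/(1-y+y²)`). -/
def eR2 : RFun 1 := ⟨2, 1 - X 0 + X 0 ^ 2, q3_ne⟩
/-- `E = 1/(1 - y + y²)` (`R_E = (1+y)/(1-y+y²)`). -/
def eR3 : RFun 1 := ⟨1, 1 - X 0 + X 0 ^ 2, q3_ne⟩
/-- `E = 2/(1 + y²)` (`R_E = (1+y)²/(1+y²)`). -/
def eR4 : RFun 1 := ⟨2, 1 + X 0 ^ 2, q4_ne⟩
/-- `E = 1/(1 + y²)` (`R_E = (1+y)/(1+y²)`; also the arctangent density of §6). -/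
def eR5 : RFun 1 := ⟨1, 1 + X 0 ^ 2, q4_ne⟩
/-- `E = 1/(1 + y + y²)` (`R_E = (1+y)²/(1+y+y²)`). -/
def eR6 : RFun 1 := ⟨1, 1 + X 0 + X 0 ^ 2, q6_ne⟩

/-- `ev_eOne`: auxiliary theorem of the log-fibre calculus for `RationalCubePiKernelSingle` (stmt-26322) — see the module docstring; verbatim from the lens-2 g6 file. -/
@[simp] theorem ev_eOne (t : ℝ) : ev eOne t = 1 := by simp [ev, eOne]
/-- `ev_eY`: auxiliary theorem of the log-fibre calculus for `RationalCubePiKernelSingle` (stmt-26322) — see the module docstring; verbatim from the lens-2 g6 file. -/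
@[simp] theorem ev_eY (t : ℝ) : ev eY t = t := by simp [ev, eY]
/-- `ev_eYsq`: auxiliary theorem of the log-fibre calculus for `RationalCubePiKernelSingle` (stmt-26322) — see the module docstring; verbatim from the lens-2 g6 file. -/
@[simp] theorem ev_eYsq (t : ℝ) : ev eYsq t = t ^ 2 := by simp [ev, eYsq]
/-- `ev_e1Y`: auxiliary theorem of the log-fibre calculus for `RationalCubePiKernelSingle` (stmt-26322) — see the module docstring; verbatim from the lens-2 g6 file. -/
@[simp] theorem ev_e1Y (t : ℝ) : ev e1Y t = 1 + t := by simp [ev, e1Y]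
/-- `ev_eYY3`: auxiliary theorem of the log-fibre calculus for `RationalCubePiKernelSingle` (stmt-26322) — see the module docstring; verbatim from the lens-2 g6 file. -/
@[simp] theorem ev_eYY3 (t : ℝ) : ev eYY3 t = t + t ^ 3 := by simp [ev, eYY3]
/-- `ev_eT1`: auxiliary theorem of the log-fibre calculus for `RationalCubePiKernelSingle` (stmt-26322) — see the module docstring; verbatim from the lens-2 g6 file. -/
@[simp] theorem ev_eT1 (t : ℝ) : ev eT1 t = 1 + t + t ^ 2 + t ^ 3 + t ^ 4 := by simp [ev, eT1]
/-- `ev_e2Y`: auxiliary theorem of the log-fibre calculus for `RationalCubePiKernelSingle` (stmt-26322) — see the module docstring; verbatim from the lens-2 g6 file. -/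
@[simp] theorem ev_e2Y (t : ℝ) : ev e2Y t = 2 + t := by simp [ev, e2Y]
/-- `ev_e1YY2`: auxiliary theorem of the log-fibre calculus for `RationalCubePiKernelSingle` (stmt-26322) — see the module docstring; verbatim from the lens-2 g6 file. -/
@[simp] theorem ev_e1YY2 (t : ℝ) : ev e1YY2 t = 1 + t + t ^ 2 := by simp [ev, e1YY2]
/-- `ev_e22YY2`: auxiliary theorem of the log-fibre calculus for `RationalCubePiKernelSingle` (stmt-26322) — see the module docstring; verbatim from the lens-2 g6 file. -/
@[simp] theorem ev_e22YY2 (t : ℝ) : ev e22YY2 t = 2 + 2 * t + t ^ 2 := by simp [ev, e22YY2]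
/-- `ev_eR2`: auxiliary theorem of the log-fibre calculus for `RationalCubePiKernelSingle` (stmt-26322) — see the module docstring; verbatim from the lens-2 g6 file. -/
@[simp] theorem ev_eR2 (t : ℝ) : ev eR2 t = 2 / (1 - t + t ^ 2) := by simp [ev, eR2, fn_apply]
/-- `ev_eR3`: auxiliary theorem of the log-fibre calculus for `RationalCubePiKernelSingle` (stmt-26322) — see the module docstring; verbatim from the lens-2 g6 file. -/
@[simp] theorem ev_eR3 (t : ℝ) : ev eR3 t = 1 / (1 - t + t ^ 2) := by simp [ev, eR3, fn_apply]
/-- `ev_eR4`: auxiliary theorem of the log-fibre calculus for `RationalCubePiKernelSingle` (stmt-26322) — see the module docstring; verbatim from the lens-2 g6 file. -/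
@[simp] theorem ev_eR4 (t : ℝ) : ev eR4 t = 2 / (1 + t ^ 2) := by simp [ev, eR4, fn_apply]
/-- `ev_eR5`: auxiliary theorem of the log-fibre calculus for `RationalCubePiKernelSingle` (stmt-26322) — see the module docstring; verbatim from the lens-2 g6 file. -/
@[simp] theorem ev_eR5 (t : ℝ) : ev eR5 t = 1 / (1 + t ^ 2) := by simp [ev, eR5, fn_apply]
/-- `ev_eR6`: auxiliary theorem of the log-fibre calculus for `RationalCubePiKernelSingle` (stmt-26322) — see the module docstring; verbatim from the lens-2 g6 file. -/
@[simp] theorem ev_eR6 (t : ℝ) : ev eR6 t = 1 / (1 + t + t ^ 2) := by simp [ev, eR6, fn_apply]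

/-- `quad3_pos`: auxiliary theorem of the log-fibre calculus for `RationalCubePiKernelSingle` (stmt-26322) — see the module docstring; verbatim from the lens-2 g6 file. -/
theorem quad3_pos (t : ℝ) : 0 < 1 - t + t ^ 2 := by nlinarith [sq_nonneg (t - 1 / 2)]

/-- `eOne_nn`: auxiliary theorem of the log-fibre calculus for `RationalCubePiKernelSingle` (stmt-26322) — see the module docstring; verbatim from the lens-2 g6 file. -/
theorem eOne_nn : ∀ t ∈ Icc (0 : ℝ) 1, 0 ≤ ev eOne t := fun t _ => by simp
/-- `eY_nn`: auxiliary theorem of the log-fibre calculus for `RationalCubePiKernelSingle` (stmt-26322) — see the module docstring; verbatim from the lens-2 g6 file. -/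
theorem eY_nn : ∀ t ∈ Icc (0 : ℝ) 1, 0 ≤ ev eY t := fun t ht => by simpa using ht.1
/-- `eYsq_nn`: auxiliary theorem of the log-fibre calculus for `RationalCubePiKernelSingle` (stmt-26322) — see the module docstring; verbatim from the lens-2 g6 file. -/
theorem eYsq_nn : ∀ t ∈ Icc (0 : ℝ) 1, 0 ≤ ev eYsq t := fun t _ => by simp; positivity
/-- `e1Y_nn`: auxiliary theorem of the log-fibre calculus for `RationalCubePiKernelSingle` (stmt-26322) — see the module docstring; verbatim from the lens-2 g6 file. -/
theorem e1Y_nn : ∀ t ∈ Icc (0 : ℝ) 1, 0 ≤ ev e1Y t := fun t ht => by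
  have := ht.1; simp; positivity
/-- `eYY3_nn`: auxiliary theorem of the log-fibre calculus for `RationalCubePiKernelSingle` (stmt-26322) — see the module docstring; verbatim from the lens-2 g6 file. -/
theorem eYY3_nn : ∀ t ∈ Icc (0 : ℝ) 1, 0 ≤ ev eYY3 t := fun t ht => by
  have := ht.1; simp; positivity
/-- `eT1_nn`: auxiliary theorem of the log-fibre calculus for `RationalCubePiKernelSingle` (stmt-26322) — see the module docstring; verbatim from the lens-2 g6 file. -/
theorem eT1_nn : ∀ t ∈ Icc (0 : ℝ) 1, 0 ≤ ev eT1 t := fun t ht => by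
  have := ht.1; simp; positivity
/-- `e2Y_nn`: auxiliary theorem of the log-fibre calculus for `RationalCubePiKernelSingle` (stmt-26322) — see the module docstring; verbatim from the lens-2 g6 file. -/
theorem e2Y_nn : ∀ t ∈ Icc (0 : ℝ) 1, 0 ≤ ev e2Y t := fun t ht => by
  have := ht.1; simp; positivity
/-- `e1YY2_nn`: auxiliary theorem of the log-fibre calculus for `RationalCubePiKernelSingle` (stmt-26322) — see the module docstring; verbatim from the lens-2 g6 file. -/
theorem e1YY2_nn : ∀ t ∈ Icc (0 : ℝ) 1, 0 ≤ ev e1YY2 t := fun t ht => by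
  have := ht.1; simp; positivity
/-- `e22YY2_nn`: auxiliary theorem of the log-fibre calculus for `RationalCubePiKernelSingle` (stmt-26322) — see the module docstring; verbatim from the lens-2 g6 file. -/
theorem e22YY2_nn : ∀ t ∈ Icc (0 : ℝ) 1, 0 ≤ ev e22YY2 t := fun t ht => by
  have := ht.1; simp; positivity
/-- `eR2_nn`: auxiliary theorem of the log-fibre calculus for `RationalCubePiKernelSingle` (stmt-26322) — see the module docstring; verbatim from the lens-2 g6 file. -/
theorem eR2_nn : ∀ t ∈ Icc (0 : ℝ) 1, 0 ≤ ev eR2 t := fun t _ => by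
  rw [ev_eR2]; exact div_nonneg zero_le_two (quad3_pos t).le
/-- `eR3_nn`: auxiliary theorem of the log-fibre calculus for `RationalCubePiKernelSingle` (stmt-26322) — see the module docstring; verbatim from the lens-2 g6 file. -/
theorem eR3_nn : ∀ t ∈ Icc (0 : ℝ) 1, 0 ≤ ev eR3 t := fun t _ => by
  rw [ev_eR3]; exact div_nonneg zero_le_one (quad3_pos t).le
/-- `eR4_nn`: auxiliary theorem of the log-fibre calculus for `RationalCubePiKernelSingle` (stmt-26322) — see the module docstring; verbatim from the lens-2 g6 file. -/
theorem eR4_nn : ∀ t ∈ Icc (0 : ℝ) 1, 0 ≤ ev eR4 t := fun t _ => by rw [ev_eR4]; positivity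
/-- `eR5_nn`: auxiliary theorem of the log-fibre calculus for `RationalCubePiKernelSingle` (stmt-26322) — see the module docstring; verbatim from the lens-2 g6 file. -/
theorem eR5_nn : ∀ t ∈ Icc (0 : ℝ) 1, 0 ≤ ev eR5 t := fun t _ => by rw [ev_eR5]; positivity
/-- `eR6_nn`: auxiliary theorem of the log-fibre calculus for `RationalCubePiKernelSingle` (stmt-26322) — see the module docstring; verbatim from the lens-2 g6 file. -/
theorem eR6_nn : ∀ t ∈ Icc (0 : ℝ) 1, 0 ≤ ev eR6 t := fun t ht => by
  have := ht.1; rw [ev_eR6]; positivity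

/-- `Λ[1] = [□, 1/(1+xy)]`. -/
def lOne : RFun 2 := lam eOne eOne_nn
/-- `Λ[y]`. -/
def lY : RFun 2 := lam eY eY_nn
/-- `Λ[y²]`. -/
def lYsq : RFun 2 := lam eYsq eYsq_nn
/-- `Λ[1+y]`. -/
def l1Y : RFun 2 := lam e1Y e1Y_nn
/-- `Λ[y+y³]`. -/
def lYY3 : RFun 2 := lam eYY3 eYY3_nn
/-- `Λ[1+y+y²+y³+y⁴]`. -/
def lT1 : RFun 2 := lam eT1 eT1_nn
/-- `Λ[2+y]`. -/
def l2Y : RFun 2 := lam e2Y e2Y_nn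
/-- `Λ[1+y+y²]`. -/
def l1YY2 : RFun 2 := lam e1YY2 e1YY2_nn
/-- `Λ[2+2y+y²]`. -/
def l22YY2 : RFun 2 := lam e22YY2 e22YY2_nn
/-- `Λ[2/(1-y+y²)] = [□, 2/(1-y+y²+2xy)]`. -/
def lR2 : RFun 2 := lam eR2 eR2_nn
/-- `Λ[1/(1-y+y²)] = [□, 1/(1-y+y²+xy)]`. -/
def lR3 : RFun 2 := lam eR3 eR3_nn
/-- `Λ[2/(1+y²)] = [□, 2/(1+y²+2xy)]`. -/
def lR4 : RFun 2 := lam eR4 eR4_nn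
/-- `Λ[1/(1+y²)] = [□, 1/(1+y²+xy)]`. -/
def lR5 : RFun 2 := lam eR5 eR5_nn
/-- `Λ[1/(1+y+y²)] = [□, 1/(1+y+y²+xy)]`. -/
def lR6 : RFun 2 := lam eR6 eR6_nn

/-! ### The relations (three power rules, ten product rules) -/

/-- `w1`: `Λ[1] ≡ 2•Λ[y]` (power rule `k = 2`: `R = 1+y ↦ 1+y²`). -/
theorem w1 : KZ.of lOne.rep - 2 • KZ.of lY.rep ∈ KZ.relations :=
  lam_pow 1 eOne_nn eY_nn fun t _ => by simp only [ev_eY, ev_eOne, pow_one, mul_one]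
/-- `w2`: `Λ[1] ≡ 3•Λ[y²]` (power rule `k = 3`). -/
theorem w2 : KZ.of lOne.rep - 3 • KZ.of lYsq.rep ∈ KZ.relations :=
  lam_pow 2 eOne_nn eYsq_nn fun t _ => by simp only [ev_eYsq, ev_eOne, mul_one]
/-- `w3`: `Λ[1+y] ≡ 2•Λ[y+y³]` (power rule `k = 2` for `R = Φ₃`). -/
theorem w3 : KZ.of l1Y.rep - 2 • KZ.of lYY3.rep ∈ KZ.relations :=
  lam_pow 1 e1Y_nn eYY3_nn fun t _ => by simp only [ev_eYY3, ev_e1Y]; ring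

end Census

end Summit.KontsevichZagierPeriods.RootDecompRationalCubeDichotomy.LogFibre

end
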